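import Literature.Analysis.Fourier.HilbertTransformLineSplit
import Literature.Analysis.Fourier.HilbertTransformLineMoment
import Mathlib.Analysis.Complex.RealDeriv
import Mathlib.Analysis.Calculus.Deriv.Inv
import Mathlib.Analysis.Calculus.Deriv.Pow
import Mathlib.MeasureTheory.Integral.IntegralEqImproper
import Mathlib.MeasureTheory.Measure.Haar.NormedSpace
import HarnessLib

/-!
# The Hilbert transform of the rational functions `(L − iξ)^{−k}`: `H` acts as `−i` on the upper-half-plane class

Topic `Literature/Analysis/Fourier`. For `L > 0` and `k ≥ 1` the rational function `u_k(ξ) = (L − iξ)^{−k} = i^k (ξ + iL)^{−k}`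
is the boundary value of a function holomorphic in the upper half-plane and `O(|z|^{−k})` at infinity, so the line Hilbert
transform `H = hilbertTransform` of `HilbertTransformLine.lean` (convention `Hf(x) = π⁻¹ p.v.∫ f(y)/(x−y) dy`, `H cos = sin`) acts on
it as multiplication by `−i`; in real terms

  **`H(Re u_k) = Im u_k`,  `H(Im u_k) = −Re u_k`  (`k ≥ 1`)**  — `hilbertTransform_cayleyInvPow`.

This is entry (2.2) of King's table (`H[(x + a)^{−1}] = −i(x + a)^{−1}`, `Im a > 0`) and its derivatives (entry (1.21)); for `k = 1`
it is the Poisson / conjugate-Poisson pair (entries (2.4), (2.5)), already in the tree as `hilbertTransform_poissonKernel`.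
[cite: King2009HilbertTransforms2, Appendix 1, Table 1.2 entries (2.2), (2.4), (2.5); Table 1.1 entries (1.14), (1.21)]
[cite: Grafakos2014, Ex. 5.1.8 and eq. (5.1.17)]

The proof stays inside the tree's real p.v. calculus (no contour integration): `k = 1` is the Poisson pair plus the moment formula
`H[y f](x) = x·Hf(x) − π⁻¹∫f` (`hilbertTransform_mul_id`, King (1.14)) applied to `f = (L² + y²)⁻¹` (`∫ f = π/L`); the step
`k → k + 1` reads the recursion `u_k = u_{k+1}·(L − iξ)` in real and imaginary parts, applies the moment formula to the parts of
`u_{k+1}` — which are `C¹ ∩ L¹` with MEAN ZERO (`u_{k+1} = (u_k)′/(ik)` and `u_k → 0` at `±∞`) — and solves the resulting `2 × 2`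
linear system with determinant `L² + x²`. Along the way: smoothness, the size bound `|u_k| ≤ L^{2−k}(L² + ξ²)⁻¹` (`k ≥ 2`),
integrability, the derivative `u_k′ = ik·u_{k+1}`, decay, and the mean-zero property of `u_k` (`k ≥ 2`).

Used by the SHEET-ℝ certificate frame of cell ns-blowup (`Summits/NavierStokesRegularity/OSWSelfSimilar/SheetRCayleyHilbert.lean`:
the Cayley frame `(1 + cos θ)e^{inθ}`, `ξ = L tan(θ/2)`, is a finite real combination of `u_2, …, u_{n+1}`). No definition; the
functions are written inline as `(((L : ℂ) − I·ξ)^k)⁻¹`.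
-/

namespace Literature.Analysis.Fourier

open _root_.MeasureTheory Set Filter Complex
open scoped Real Topology

/-! ### The Cayley denominator `w(ξ) = L − iξ` and the functions `u_k = w^{-k}` : algebra -/

/-- `L − iξ ≠ 0` for `L > 0`: the table entry's function `(x + a)^{-1}`, `a = iL`, `Im a > 0`, has no real pole.
[cite: King2009HilbertTransforms2, Appendix 1, Table 1.2 entry (2.2) (the side condition `Im a > 0`)] -/
theorem cayleyDen_ne_zero {L : ℝ} (hL : 0 < L) (ξ : ℝ) : (L : ℂ) - I * ξ ≠ 0 := by
  intro h
  have := congrArg Complex.re h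
  simp at this
  exact hL.ne' this

/-- `‖L − iξ‖² = L² + ξ²`. [folklore] -/
private theorem norm_sq_cayleyDen (L ξ : ℝ) : ‖(L : ℂ) - I * ξ‖ ^ 2 = L ^ 2 + ξ ^ 2 := by
  rw [Complex.sq_norm, Complex.normSq_apply]
  simp
  ring

/-- `L ≤ ‖L − iξ‖` (for `L ≥ 0`). [folklore] -/
private theorem le_norm_cayleyDen {L : ℝ} (hL : 0 ≤ L) (ξ : ℝ) : L ≤ ‖(L : ℂ) - I * ξ‖ := by
  have h := Complex.abs_re_le_norm ((L : ℂ) - I * ξ)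
  simp at h
  rwa [abs_of_nonneg hL] at h

/-- `|ξ| ≤ ‖L − iξ‖`. [folklore] -/
private theorem abs_le_norm_cayleyDen (L ξ : ℝ) : |ξ| ≤ ‖(L : ℂ) - I * ξ‖ := by
  have h := Complex.abs_im_le_norm ((L : ℂ) - I * ξ)
  simpa using h

/-- `(L − iξ)⁻¹ = (L + iξ)/(L² + ξ²)`: real part `L/(L²+ξ²)`, imaginary part `ξ/(L²+ξ²)`. [folklore] -/
private theorem inv_cayleyDen_re (L ξ : ℝ) :
    (((L : ℂ) - I * ξ)⁻¹).re = L / (L ^ 2 + ξ ^ 2) := by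
  rw [Complex.inv_re, ← Complex.sq_norm, norm_sq_cayleyDen]
  simp

/-- Imaginary part of `(L − iξ)⁻¹`. [folklore] -/
private theorem inv_cayleyDen_im (L ξ : ℝ) :
    (((L : ℂ) - I * ξ)⁻¹).im = ξ / (L ^ 2 + ξ ^ 2) := by
  rw [Complex.inv_im, ← Complex.sq_norm, norm_sq_cayleyDen]
  simp

/-- The recursion `w^{-k} = w^{-(k+1)} · w` read in real and imaginary parts (real part):
`Re w^{-k} = L · Re w^{-(k+1)} + ξ · Im w^{-(k+1)}`. [folklore] -/
private theorem cayleyInvPow_re_succ {L : ℝ} (hL : 0 < L) (k : ℕ) (ξ : ℝ) :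
    ((((L : ℂ) - I * ξ) ^ k)⁻¹).re =
      L * ((((L : ℂ) - I * ξ) ^ (k + 1))⁻¹).re + ξ * ((((L : ℂ) - I * ξ) ^ (k + 1))⁻¹).im := by
  have hw := cayleyDen_ne_zero hL ξ
  have h : (((L : ℂ) - I * ξ) ^ k)⁻¹ = (((L : ℂ) - I * ξ) ^ (k + 1))⁻¹ * ((L : ℂ) - I * ξ) := by
    rw [pow_succ, mul_inv, mul_assoc, inv_mul_cancel₀ hw, mul_one]
  rw [h, Complex.mul_re]
  simp
  ring

/-- The recursion in imaginary parts: `Im w^{-k} = L · Im w^{-(k+1)} − ξ · Re w^{-(k+1)}`. [folklore] -/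
private theorem cayleyInvPow_im_succ {L : ℝ} (hL : 0 < L) (k : ℕ) (ξ : ℝ) :
    ((((L : ℂ) - I * ξ) ^ k)⁻¹).im =
      L * ((((L : ℂ) - I * ξ) ^ (k + 1))⁻¹).im - ξ * ((((L : ℂ) - I * ξ) ^ (k + 1))⁻¹).re := by
  have hw := cayleyDen_ne_zero hL ξ
  have h : (((L : ℂ) - I * ξ) ^ k)⁻¹ = (((L : ℂ) - I * ξ) ^ (k + 1))⁻¹ * ((L : ℂ) - I * ξ) := by
    rw [pow_succ, mul_inv, mul_assoc, inv_mul_cancel₀ hw, mul_one]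
  rw [h, Complex.mul_im]
  simp
  ring

/-! ### Analysis of `u_k`: smoothness, size, integrability, derivative, limits, mean zero -/

/-- `ξ ↦ (L − iξ)^{-k}` is `C^∞` on `ℝ` (as a `ℂ`-valued function of a real variable): the table entry's function
`(x + a)^{-k}`, `Im a > 0`, is smooth on the real line.
[cite: King2009HilbertTransforms2, Appendix 1, Table 1.2 entry (2.2) with Table 1.1 entry (1.21) (derivatives)] -/
theorem contDiff_cayleyInvPow {L : ℝ} (hL : 0 < L) (k : ℕ) {m : WithTop ℕ∞} :
    ContDiff ℝ m (fun ξ : ℝ => (((L : ℂ) - I * ξ) ^ k)⁻¹) := by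
  have h1 : ContDiff ℝ m (fun ξ : ℝ => (L : ℂ) - I * ξ) :=
    contDiff_const.sub (contDiff_const.mul Complex.ofRealCLM.contDiff)
  exact (h1.pow k).inv fun ξ => pow_ne_zero k (cayleyDen_ne_zero hL ξ)

/-- Real part of `(L − iξ)^{-k}` is `C¹`. [folklore] -/
private theorem contDiff_cayleyInvPow_re {L : ℝ} (hL : 0 < L) (k : ℕ) :
    ContDiff ℝ 1 (fun ξ : ℝ => ((((L : ℂ) - I * ξ) ^ k)⁻¹).re) :=
  Complex.reCLM.contDiff.comp (contDiff_cayleyInvPow hL k)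

/-- Imaginary part of `(L − iξ)^{-k}` is `C¹`. [folklore] -/
private theorem contDiff_cayleyInvPow_im {L : ℝ} (hL : 0 < L) (k : ℕ) :
    ContDiff ℝ 1 (fun ξ : ℝ => ((((L : ℂ) - I * ξ) ^ k)⁻¹).im) :=
  Complex.imCLM.contDiff.comp (contDiff_cayleyInvPow hL k)

/-- Size: `‖(L − iξ)^{-k}‖ ≤ L^{-(k−2)} (L² + ξ²)⁻¹` for `k ≥ 2`. [folklore] -/
private theorem norm_cayleyInvPow_le {L : ℝ} (hL : 0 < L) {k : ℕ} (hk : 2 ≤ k) (ξ : ℝ) :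
    ‖(((L : ℂ) - I * ξ) ^ k)⁻¹‖ ≤ L⁻¹ ^ (k - 2) * (L ^ 2 + ξ ^ 2)⁻¹ := by
  have hw := cayleyDen_ne_zero hL ξ
  have hnorm : 0 < ‖(L : ℂ) - I * ξ‖ := norm_pos_iff.2 hw
  obtain ⟨j, rfl⟩ : ∃ j, k = j + 2 := ⟨k - 2, by omega⟩
  rw [norm_inv, norm_pow, Nat.add_sub_cancel, ← inv_pow, pow_add]
  have h2 : ‖(L : ℂ) - I * ξ‖⁻¹ ^ 2 = (L ^ 2 + ξ ^ 2)⁻¹ := by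
    rw [inv_pow, norm_sq_cayleyDen]
  rw [h2]
  gcongr
  exact le_norm_cayleyDen hL.le ξ

/-- `(L² + ξ²)⁻¹` is integrable on `ℝ`. [folklore] -/
private theorem integrable_inv_sq_add_sq_cayley {L : ℝ} (hL : 0 < L) :
    Integrable fun ξ : ℝ => (L ^ 2 + ξ ^ 2)⁻¹ := by
  have h := (integrable_inv_one_add_sq.comp_div hL.ne').const_mul (L ^ 2)⁻¹
  refine h.congr (Eventually.of_forall fun ξ => ?_)
  have hL2 : L ^ 2 ≠ 0 := by positivity
  simp only
  field_simp

/-- `(L − iξ)^{-k}` is integrable on `ℝ` for `k ≥ 2` (`|(L − iξ)^{-k}| ≤ L^{2−k}(L² + ξ²)⁻¹`): the integrable members of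
the table's family `(x + a)^{-k}`, `Im a > 0`.
[cite: King2009HilbertTransforms2, Appendix 1, Table 1.2 entries (2.2), (2.13) (rational functions with poles off the axis)] -/
theorem integrable_cayleyInvPow {L : ℝ} (hL : 0 < L) {k : ℕ} (hk : 2 ≤ k) :
    Integrable fun ξ : ℝ => (((L : ℂ) - I * ξ) ^ k)⁻¹ := by
  refine Integrable.mono' ((integrable_inv_sq_add_sq_cayley hL).const_mul (L⁻¹ ^ (k - 2)))
    (contDiff_cayleyInvPow hL k (m := 1)).continuous.aestronglyMeasurable
    (Eventually.of_forall fun ξ => norm_cayleyInvPow_le hL hk ξ)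

/-- Real part of `(L − iξ)^{-k}` is integrable for `k ≥ 2`. [folklore] -/
private theorem integrable_cayleyInvPow_re {L : ℝ} (hL : 0 < L) {k : ℕ} (hk : 2 ≤ k) :
    Integrable fun ξ : ℝ => ((((L : ℂ) - I * ξ) ^ k)⁻¹).re :=
  (integrable_cayleyInvPow hL hk).re

/-- Imaginary part of `(L − iξ)^{-k}` is integrable for `k ≥ 2`. [folklore] -/
private theorem integrable_cayleyInvPow_im {L : ℝ} (hL : 0 < L) {k : ℕ} (hk : 2 ≤ k) :
    Integrable fun ξ : ℝ => ((((L : ℂ) - I * ξ) ^ k)⁻¹).im :=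
  (integrable_cayleyInvPow hL hk).im

/-- Derivative: `d/dξ (L − iξ)^{-k} = i k (L − iξ)^{-(k+1)}`. [folklore] -/
private theorem hasDerivAt_cayleyInvPow {L : ℝ} (hL : 0 < L) (k : ℕ) (ξ : ℝ) :
    HasDerivAt (fun ξ : ℝ => (((L : ℂ) - I * ξ) ^ k)⁻¹)
      (I * k * (((L : ℂ) - I * ξ) ^ (k + 1))⁻¹) ξ := by
  have hw := cayleyDen_ne_zero hL ξ
  have h1 : HasDerivAt (fun ξ : ℝ => (L : ℂ) - I * ξ) (-(I * 1)) ξ :=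
    ((hasDerivAt_id ξ).ofReal_comp.const_mul I).const_sub (L : ℂ)
  have h2 := (h1.fun_pow k).fun_inv (pow_ne_zero k hw)
  refine h2.congr_deriv ?_
  rcases Nat.eq_zero_or_pos k with rfl | hk
  · simp
  · obtain ⟨j, rfl⟩ : ∃ j, k = j + 1 := ⟨k - 1, by omega⟩
    rw [Nat.add_sub_cancel]
    field_simp
    ring

/-- `(L − iξ)^{-k} → 0` as `ξ → +∞` (`k ≥ 1`). [folklore] -/
private theorem tendsto_cayleyInvPow_atTop {L : ℝ} (hL : 0 < L) {k : ℕ} (hk : 1 ≤ k) :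
    Tendsto (fun ξ : ℝ => (((L : ℂ) - I * ξ) ^ k)⁻¹) atTop (𝓝 0) := by
  refine squeeze_zero_norm' ?_ (tendsto_inv_atTop_zero.comp tendsto_abs_atTop_atTop)
  filter_upwards [eventually_ge_atTop (1 : ℝ)] with ξ hξ
  have hw := cayleyDen_ne_zero hL ξ
  have hnorm : 0 < ‖(L : ℂ) - I * ξ‖ := norm_pos_iff.2 hw
  have hξ' : 1 ≤ |ξ| := by rw [abs_of_nonneg (by linarith)]; exact hξ
  have hge : |ξ| ≤ ‖(L : ℂ) - I * ξ‖ := abs_le_norm_cayleyDen L ξ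
  rw [norm_inv, norm_pow, ← inv_pow]
  calc ‖(L : ℂ) - I * ξ‖⁻¹ ^ k ≤ ‖(L : ℂ) - I * ξ‖⁻¹ ^ 1 :=
        pow_le_pow_of_le_one (inv_nonneg.2 hnorm.le) (inv_le_one_of_one_le₀ (hξ'.trans hge)) hk
    _ ≤ |ξ|⁻¹ := by
        rw [pow_one]
        exact (inv_le_inv₀ hnorm (by linarith)).2 hge

/-- `(L − iξ)^{-k} → 0` as `ξ → −∞` (`k ≥ 1`). [folklore] -/
private theorem tendsto_cayleyInvPow_atBot {L : ℝ} (hL : 0 < L) {k : ℕ} (hk : 1 ≤ k) :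
    Tendsto (fun ξ : ℝ => (((L : ℂ) - I * ξ) ^ k)⁻¹) atBot (𝓝 0) := by
  refine squeeze_zero_norm' ?_ (tendsto_inv_atTop_zero.comp tendsto_abs_atBot_atTop)
  filter_upwards [eventually_le_atBot (-1 : ℝ)] with ξ hξ
  have hw := cayleyDen_ne_zero hL ξ
  have hnorm : 0 < ‖(L : ℂ) - I * ξ‖ := norm_pos_iff.2 hw
  have hξ' : 1 ≤ |ξ| := by rw [abs_of_nonpos (by linarith)]; linarith
  have hge : |ξ| ≤ ‖(L : ℂ) - I * ξ‖ := abs_le_norm_cayleyDen L ξ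
  rw [Function.comp_apply, norm_inv, norm_pow, ← inv_pow]
  calc ‖(L : ℂ) - I * ξ‖⁻¹ ^ k ≤ ‖(L : ℂ) - I * ξ‖⁻¹ ^ 1 :=
        pow_le_pow_of_le_one (inv_nonneg.2 hnorm.le) (inv_le_one_of_one_le₀ (hξ'.trans hge)) hk
    _ ≤ |ξ|⁻¹ := by
        rw [pow_one]
        exact (inv_le_inv₀ hnorm (by linarith)).2 hge

/-- Derivative of the imaginary part: `(Im w^{-k})′ = k · Re w^{-(k+1)}`. [folklore] -/
private theorem hasDerivAt_cayleyInvPow_im {L : ℝ} (hL : 0 < L) (k : ℕ) (ξ : ℝ) :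
    HasDerivAt (fun ξ : ℝ => ((((L : ℂ) - I * ξ) ^ k)⁻¹).im)
      (k * ((((L : ℂ) - I * ξ) ^ (k + 1))⁻¹).re) ξ := by
  have h := Complex.imCLM.hasFDerivAt.comp_hasDerivAt ξ (hasDerivAt_cayleyInvPow hL k ξ)
  refine h.congr_deriv ?_
  simp [Complex.mul_im, Complex.mul_re]

/-- Derivative of the real part: `(Re w^{-k})′ = −k · Im w^{-(k+1)}`. [folklore] -/
private theorem hasDerivAt_cayleyInvPow_re {L : ℝ} (hL : 0 < L) (k : ℕ) (ξ : ℝ) :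
    HasDerivAt (fun ξ : ℝ => ((((L : ℂ) - I * ξ) ^ k)⁻¹).re)
      (-(k * ((((L : ℂ) - I * ξ) ^ (k + 1))⁻¹).im)) ξ := by
  have h := Complex.reCLM.hasFDerivAt.comp_hasDerivAt ξ (hasDerivAt_cayleyInvPow hL k ξ)
  refine h.congr_deriv ?_
  simp [Complex.mul_im, Complex.mul_re]

/-- Mean zero of the real part: `∫_ℝ Re (L − iξ)^{-k} dξ = 0` for `k ≥ 2` (it is the derivative of the
decaying function `Im (L − iξ)^{-(k−1)}/(k−1)`). [folklore] -/
private theorem integral_cayleyInvPow_re {L : ℝ} (hL : 0 < L) {k : ℕ} (hk : 2 ≤ k) :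
    ∫ ξ : ℝ, ((((L : ℂ) - I * ξ) ^ k)⁻¹).re = 0 := by
  obtain ⟨j, rfl⟩ : ∃ j, k = j + 1 := ⟨k - 1, by omega⟩
  have hj : 1 ≤ j := by omega
  have hj0 : (j : ℝ) ≠ 0 := by exact_mod_cast (by omega : j ≠ 0)
  have hint : Integrable fun ξ : ℝ => (j : ℝ) * ((((L : ℂ) - I * ξ) ^ (j + 1))⁻¹).re :=
    (integrable_cayleyInvPow_re hL hk).const_mul _
  have hbot : Tendsto (fun ξ : ℝ => ((((L : ℂ) - I * ξ) ^ j)⁻¹).im) atBot (𝓝 0) := by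
    have h := (Complex.continuous_im.tendsto (0 : ℂ)).comp (tendsto_cayleyInvPow_atBot hL hj)
    rw [Complex.zero_im] at h
    exact h
  have htop : Tendsto (fun ξ : ℝ => ((((L : ℂ) - I * ξ) ^ j)⁻¹).im) atTop (𝓝 0) := by
    have h := (Complex.continuous_im.tendsto (0 : ℂ)).comp (tendsto_cayleyInvPow_atTop hL hj)
    rw [Complex.zero_im] at h
    exact h
  have h := integral_of_hasDerivAt_of_tendsto (fun ξ => hasDerivAt_cayleyInvPow_im hL j ξ) hint hbot htop
  rw [integral_const_mul, sub_zero] at h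
  exact (mul_eq_zero.1 h).resolve_left hj0

/-- Mean zero of the imaginary part: `∫_ℝ Im (L − iξ)^{-k} dξ = 0` for `k ≥ 2`. [folklore] -/
private theorem integral_cayleyInvPow_im {L : ℝ} (hL : 0 < L) {k : ℕ} (hk : 2 ≤ k) :
    ∫ ξ : ℝ, ((((L : ℂ) - I * ξ) ^ k)⁻¹).im = 0 := by
  obtain ⟨j, rfl⟩ : ∃ j, k = j + 1 := ⟨k - 1, by omega⟩
  have hj : 1 ≤ j := by omega
  have hj0 : (j : ℝ) ≠ 0 := by exact_mod_cast (by omega : j ≠ 0)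
  have hint : Integrable fun ξ : ℝ => -((j : ℝ) * ((((L : ℂ) - I * ξ) ^ (j + 1))⁻¹).im) :=
    ((integrable_cayleyInvPow_im hL hk).const_mul _).neg
  have hbot : Tendsto (fun ξ : ℝ => ((((L : ℂ) - I * ξ) ^ j)⁻¹).re) atBot (𝓝 0) := by
    have h := (Complex.continuous_re.tendsto (0 : ℂ)).comp (tendsto_cayleyInvPow_atBot hL hj)
    rw [Complex.zero_re] at h
    exact h
  have htop : Tendsto (fun ξ : ℝ => ((((L : ℂ) - I * ξ) ^ j)⁻¹).re) atTop (𝓝 0) := by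
    have h := (Complex.continuous_re.tendsto (0 : ℂ)).comp (tendsto_cayleyInvPow_atTop hL hj)
    rw [Complex.zero_re] at h
    exact h
  have h := integral_of_hasDerivAt_of_tendsto (fun ξ => hasDerivAt_cayleyInvPow_re hL j ξ) hint hbot htop
  rw [integral_neg, integral_const_mul, sub_zero, neg_eq_zero] at h
  exact (mul_eq_zero.1 h).resolve_left hj0

/-! ### Two bookkeeping lemmas for the symmetric Hilbert integrand -/

/-- If the symmetric integrand of `f` at `x` is integrable on `(0,∞)`, so is that of `c·f`. [folklore] -/
private theorem integrableOn_symmIntegrand_const_mul {f : ℝ → ℝ} {x : ℝ} (c : ℝ)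
    (hint : IntegrableOn (fun t => (f (x - t) - f (x + t)) / t) (Ioi 0)) :
    IntegrableOn (fun t => (c * f (x - t) - c * f (x + t)) / t) (Ioi 0) := by
  refine IntegrableOn.congr_fun (hint.const_mul c) (fun t _ => ?_) measurableSet_Ioi
  ring

/-- If `f` is integrable and its symmetric integrand at `x` is integrable on `(0,∞)`, then so is the symmetric
integrand of `y ↦ y·f(y)` (it equals `x·(f(x−t) − f(x+t))/t − (f(x−t) + f(x+t))`). [folklore] -/
private theorem integrableOn_symmIntegrand_mul_id {f : ℝ → ℝ} {x : ℝ} (hf : Integrable f)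
    (hint : IntegrableOn (fun t => (f (x - t) - f (x + t)) / t) (Ioi 0)) :
    IntegrableOn (fun t => ((x - t) * f (x - t) - (x + t) * f (x + t)) / t) (Ioi 0) := by
  have hA : Integrable (fun t => f (x - t)) := hf.comp_sub_left x
  have hB : Integrable (fun t => f (x + t)) := hf.comp_add_left x
  refine IntegrableOn.congr_fun ((hint.const_mul x).sub (hA.add hB).integrableOn) (fun t ht => ?_)
    measurableSet_Ioi
  have ht0 : t ≠ 0 := ne_of_gt ht
  simp only [Pi.add_apply, Pi.sub_apply]
  field_simp
  ring

/-! ### The main identity: `H(Re w^{-k}) = Im w^{-k}`, `H(Im w^{-k}) = −Re w^{-k}` -/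

/-- **`H(Re (L − iξ)^{-k}) = Im (L − iξ)^{-k}` and `H(Im (L − iξ)^{-k}) = −Re (L − iξ)^{-k}`** for every
`k ≥ 1` and `L > 0`: the functions `(L − iξ)^{-k}` are boundary values of functions holomorphic and decaying in
the upper half-plane, so the Hilbert transform (convention `H cos = sin`) acts on them as `−i`. Proved inside the
p.v. calculus of the tree: `k = 1` is the Poisson pair `H[L/(L²+y²)] = x/(L²+x²)` plus the moment formula
(`H[y·(L²+y²)⁻¹] = x·H[(L²+y²)⁻¹] − π⁻¹∫(L²+y²)⁻¹ = −L/(L²+x²)`); the step `k → k+1` reads the recursion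
`w^{-k} = w^{-(k+1)}·(L − iξ)` in real and imaginary parts, applies the moment formula to the (integrable, mean-zero,
`C¹`) parts of `w^{-(k+1)}` and solves the resulting `2 × 2` linear system.
[cite: Grafakos2014, Ex. 5.1.8 and eq. (5.1.17) (Poisson/conjugate-Poisson pair); King2009HilbertTransforms2, eq. (19.150) (moment formula)] -/
theorem hilbertTransform_cayleyInvPow {L : ℝ} (hL : 0 < L) {k : ℕ} (hk : 1 ≤ k) (x : ℝ) :
    hilbertTransform (fun ξ : ℝ => ((((L : ℂ) - I * ξ) ^ k)⁻¹).re) x = ((((L : ℂ) - I * x) ^ k)⁻¹).im ∧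
    hilbertTransform (fun ξ : ℝ => ((((L : ℂ) - I * ξ) ^ k)⁻¹).im) x = -((((L : ℂ) - I * x) ^ k)⁻¹).re := by
  induction k, hk using Nat.le_induction generalizing x with
  | base =>
    -- `k = 1`: the Poisson pair and the moment formula
    have hre : (fun ξ : ℝ => ((((L : ℂ) - I * ξ) ^ 1)⁻¹).re) = fun ξ => L / (L ^ 2 + ξ ^ 2) := by
      funext ξ; rw [pow_one, inv_cayleyDen_re]
    have him : (fun ξ : ℝ => ((((L : ℂ) - I * ξ) ^ 1)⁻¹).im) = fun ξ => ξ * (L ^ 2 + ξ ^ 2)⁻¹ := by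
      funext ξ; rw [pow_one, inv_cayleyDen_im, div_eq_mul_inv]
    have hL0 : L ≠ 0 := hL.ne'
    have hLx : L ^ 2 + x ^ 2 ≠ 0 := by positivity
    refine ⟨?_, ?_⟩
    · rw [hre, hilbertTransform_poissonKernel hL, pow_one, inv_cayleyDen_im]
    · rw [him, pow_one, inv_cayleyDen_re]
      -- `f₀ = (L²+y²)⁻¹` is `C¹ ∩ L¹`
      have hf0 : Integrable fun ξ : ℝ => (L ^ 2 + ξ ^ 2)⁻¹ := integrable_inv_sq_add_sq_cayley hL
      have hf0C : ContDiff ℝ 1 fun ξ : ℝ => (L ^ 2 + ξ ^ 2)⁻¹ := by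
        refine ContDiff.inv (by fun_prop) fun ξ => ?_
        positivity
      have hsymm := integrableOn_symmIntegrand_of_contDiff hf0C hf0 x
      rw [hilbertTransform_mul_id hf0 hsymm]
      -- `H f₀ = L⁻¹ · x/(L²+x²)` by the Poisson kernel
      have hH : hilbertTransform (fun ξ : ℝ => (L ^ 2 + ξ ^ 2)⁻¹) x = L⁻¹ * (x / (L ^ 2 + x ^ 2)) := by
        have e : (fun ξ : ℝ => (L ^ 2 + ξ ^ 2)⁻¹) = fun ξ => L⁻¹ * (L / (L ^ 2 + ξ ^ 2)) := by
          funext ξ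
          have : L ^ 2 + ξ ^ 2 ≠ 0 := by positivity
          field_simp
        rw [e, hilbertTransform_const_mul, hilbertTransform_poissonKernel hL]
      -- `∫ f₀ = π/L`
      have hI : ∫ ξ : ℝ, (L ^ 2 + ξ ^ 2)⁻¹ = π / L := by
        have e : (fun ξ : ℝ => (L ^ 2 + ξ ^ 2)⁻¹) = fun ξ => (L ^ 2)⁻¹ * (1 + (ξ / L) ^ 2)⁻¹ := by
          funext ξ
          have hL2 : L ^ 2 ≠ 0 := by positivity
          field_simp
        rw [e, integral_const_mul, Measure.integral_comp_div (fun y : ℝ => (1 + y ^ 2)⁻¹) L,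
          integral_univ_inv_one_add_sq, abs_of_pos hL, smul_eq_mul]
        field_simp
      rw [hH, hI]
      field_simp
      ring
  | succ k hk ih =>
    -- the parts of `w^{-(k+1)}`
    set A : ℝ → ℝ := fun ξ => ((((L : ℂ) - I * ξ) ^ (k + 1))⁻¹).re with hAdef
    set B : ℝ → ℝ := fun ξ => ((((L : ℂ) - I * ξ) ^ (k + 1))⁻¹).im with hBdef
    have hk2 : 2 ≤ k + 1 := by omega
    have hAi : Integrable A := integrable_cayleyInvPow_re hL hk2
    have hBi : Integrable B := integrable_cayleyInvPow_im hL hk2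
    have hAC : ContDiff ℝ 1 A := contDiff_cayleyInvPow_re hL (k + 1)
    have hBC : ContDiff ℝ 1 B := contDiff_cayleyInvPow_im hL (k + 1)
    have hAs := integrableOn_symmIntegrand_of_contDiff hAC hAi x
    have hBs := integrableOn_symmIntegrand_of_contDiff hBC hBi x
    have hA0 : ∫ ξ, A ξ = 0 := integral_cayleyInvPow_re hL hk2
    have hB0 : ∫ ξ, B ξ = 0 := integral_cayleyInvPow_im hL hk2
    -- `H(ξ·A) = x·HA`, `H(ξ·B) = x·HB`
    have hxA : hilbertTransform (fun ξ => ξ * A ξ) x = x * hilbertTransform A x := by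
      rw [hilbertTransform_mul_id hAi hAs, hA0, mul_zero, sub_zero]
    have hxB : hilbertTransform (fun ξ => ξ * B ξ) x = x * hilbertTransform B x := by
      rw [hilbertTransform_mul_id hBi hBs, hB0, mul_zero, sub_zero]
    -- the recursion as function identities
    have hre : (fun ξ : ℝ => ((((L : ℂ) - I * ξ) ^ k)⁻¹).re) = fun ξ => L * A ξ + ξ * B ξ := by
      funext ξ; exact cayleyInvPow_re_succ hL k ξ
    have him : (fun ξ : ℝ => ((((L : ℂ) - I * ξ) ^ k)⁻¹).im) = fun ξ => L * B ξ + (-1) * (ξ * A ξ) := by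
      funext ξ; rw [cayleyInvPow_im_succ hL k ξ]; ring
    obtain ⟨ih1, ih2⟩ := ih x
    have hLA : IntegrableOn (fun t => (L * A (x - t) - L * A (x + t)) / t) (Ioi 0) :=
      integrableOn_symmIntegrand_const_mul L hAs
    have hLB : IntegrableOn (fun t => (L * B (x - t) - L * B (x + t)) / t) (Ioi 0) :=
      integrableOn_symmIntegrand_const_mul L hBs
    have hxBs : IntegrableOn (fun t => ((x - t) * B (x - t) - (x + t) * B (x + t)) / t) (Ioi 0) :=
      integrableOn_symmIntegrand_mul_id hBi hBs
    have hxAs : IntegrableOn (fun t => ((-1) * ((x - t) * A (x - t)) - (-1) * ((x + t) * A (x + t))) / t)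
        (Ioi 0) :=
      integrableOn_symmIntegrand_const_mul (f := fun y => y * A y) (-1) (integrableOn_symmIntegrand_mul_id hAi hAs)
    rw [hre, hilbertTransform_add (f := fun y => L * A y) (g := fun y => y * B y) hLA hxBs,
      hilbertTransform_const_mul, hxB, cayleyInvPow_im_succ hL k x] at ih1
    rw [him, hilbertTransform_add (f := fun y => L * B y) (g := fun y => (-1) * (y * A y)) hLB hxAs,
      hilbertTransform_const_mul L B, hilbertTransform_const_mul (-1) (fun y => y * A y), hxA,
      cayleyInvPow_re_succ hL k x] at ih2
    -- solve the `2 × 2` system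
    have hLx : L ^ 2 + x ^ 2 ≠ 0 := by positivity
    have e1 : (L ^ 2 + x ^ 2) * (hilbertTransform A x - B x) = 0 := by
      linear_combination L * ih1 - x * ih2
    have e2 : (L ^ 2 + x ^ 2) * (hilbertTransform B x + A x) = 0 := by
      linear_combination x * ih1 + L * ih2
    have f1 := (mul_eq_zero.1 e1).resolve_left hLx
    have f2 := (mul_eq_zero.1 e2).resolve_left hLx
    exact ⟨by linarith, by linarith⟩

end Literature.Analysis.Fourier
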